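import Summits.QuantumFields.YangMills.Theorems.AlphaInputsT3ACMinimiserPin
import Summits.QuantumFields.YangMills.Theorems.BalabanUVNodesN08AlphaInB42Sel
import HarnessLib

/-!
# `AlphaInputsT3ACMinimiserPinMeasurable` — THE r1-PIN LEMMA, MEASURABLE HALF: a MEASURABLE selection `V ↦ U_{K−n}(V)` among the uniform
# witnesses of `AlphaInputsT3ACMinimiserPin.exists_uniform_regMinimiser`, and the PINNED family `U_k(·, triv)` of run `K` with the record's
# minimiser row r1 (`AlphaInputsT3ACv2.MinimiserRowsT3`, conjunct 1) AS ITS TEXT — lane `pub-balaban3d`, seat alpha-1 (g6)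

Cell `ym3-torus`, route `UnitScaleTilt`, crux 2′ `stub_laneRecordsV3` (stmt-QuantumFields-19936 ∕ -19935), strategy B (owner width-lever ruling
2026-08-27): the v3 record asks `Measurable (U_k(·, h))` at EVERY history (`RunAlphaV3AC.steps _ _ |>.hU`, `TerminalRowsT3`), so a composite-minimiser
family PINNED at the trivial history from a displayed [7] Theorem 1 must be measurable (located point (P2) of the seat's supplier table).  Here:
* §1 a real-analysis letter (`≤` at the infimum of a shell from `<` inside it) and the instances of the configuration spaces `SU(2)^{bonds}` of the
  family (compact Polish, Borel = product σ-algebra; pattern of `Node00.Record12MinimiserSelection` §3);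
* §2 ★ `exists_measurable_umin`: for `n < K` a MEASURABLE `Umin : GaugeField (F.P n) 0 → GaugeField (F.P K) 0` with r1's two clauses for every
  admissible `(ε₁, ε₀)` and every `ε₁`-small `V` — Castaing's selection (`BalabanUVNodesN08AlphaInB42Sel.exists_measurable_constrained_argmin_of_continuousOn`)
  for the Wilson action over the correspondence `V ↦ T(V)` = «descent fibre of `V` ∩ plaquettes `≤ regThreshold(B₃e(V))` ∩ divergence `≤ B₃e(V)·L^{−3(K−n)}`»
  (`e(V)` = largest plaquette deviation of `V`), whose graph is closed in an open class on which the descent is continuous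
  (`MinimiserPin.continuousAt_descendTo_of_plaqLe`) and which contains the uniform witness of the existence half, a minimiser over it;
* §3 ★★ `exists_measurable_pinnedFamily`: for every run `K` a family `UminT : (k : ℕ) → GaugeField (F.P K) k → GaugeField (F.P K) 0`, every member
  measurable, `UminT 0 = id`, and THE TEXT of `MinimiserRowsT3`'s conjunct 1 with `U_k(·, triv) := UminT k` (re-indexing `k = K − n` through
  `T3LevelShift.fieldShift`) — so that lane B's schema can display `T3PrintedMinimiserExistence.Thm1GlobalMinAt` VERBATIM and pin the record's
  trivial-history minimisers from it (`hU0` by `UminT 0 = id`; `hUs` by DEFINING `U_k := UminT (k+1)`).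
HONEST FRAMING.  Kernel theorems about the tree's own objects; NOTHING of [Balaban1985Variational] is asserted (`Thm1GlobalMinAt` displayed; print's
«`a₁` sufficiently small» in the explicit letters `C₀(3)·2B₃a₁ ≤ ⅓`, `4B₃a₁ ≤ 2δ₂/(7L)²`).  No `def`, no `instance` (local `haveI` only), no `sorry`;
count-neutral; not a claim about the continuum limit or the mass gap.
References: T. Bałaban, Commun. Math. Phys. 102 (1985) 277–309 [Balaban1985Variational], Thm 1 (6)–(8) pp. 278–279; C. D. Aliprantis, K. C. Border,
*Infinite Dimensional Analysis* (2006), Thm 18.19 p. 605 [AliprantisBorder2006].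
-/

set_option autoImplicit false

noncomputable section

namespace Summit.QuantumFields.YangMills.Theorems.MinimiserPin

open Set Filter Topology MeasureTheory
open scoped Matrix.Norms.L2Operator
open Literature.MathematicalPhysics.QuantumFieldTheory.Balaban1983to89
open Literature.MathematicalPhysics.QuantumFieldTheory.Balaban1983to89.T3ContinuumYM3Torus
open Literature.MathematicalPhysics.QuantumFieldTheory.Balaban1983to89.T3UnitLawDensityEML (ℰp)
open Literature.MathematicalPhysics.QuantumFieldTheory.Balaban1983to89.T3PrintedRegularMinimiser (RegPr DivSmall regFibrePr)
open Literature.MathematicalPhysics.QuantumFieldTheory.Balaban1983to89.T3PrintedMinimiserExistence (Thm1GlobalMinAt regFibrePr_mono regThreshold_mono)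
open Literature.MathematicalPhysics.QuantumFieldTheory.Balaban1983to89.T3RegularMinimiser (regThreshold)
open Literature.MathematicalPhysics.QuantumFieldTheory.Balaban1983to89.T3TiltDescent (descendTo)
open Literature.MathematicalPhysics.QuantumFieldTheory.Balaban1983to89.T3LevelShift (fieldShift fieldShift_fieldShift fieldShift_refl measurable_fieldShift)
open Literature.MathematicalPhysics.QuantumFieldTheory.Balaban1983to89.B10Eq27TorusAxialLog (toUField unitsField)
open Literature.MathematicalPhysics.QuantumFieldTheory.Balaban1983to89.B10Eq68TorusRegularity (covDivT)
open Literature.MathematicalPhysics.QuantumFieldTheory.Balaban1983to89.ExpMeanLog (deltaSU)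
open Literature.MathematicalPhysics.QuantumLattice (fundamentalRep continuous_fundamentalRep fundamentalRep_injective)
open Summit.QuantumFields.YangMills.BalabanUVNodes.N07DirectMethod (continuous_wilsonAction4 continuous_dist1_plaqHol)
open Summit.QuantumFields.YangMills.Theorems.Prop8Criticality (continuous_covDivT)
open Summit.QuantumFields.YangMills.Theorems.BalabanUVNodesN08AlphaInB42Sel (exists_measurable_constrained_argmin_of_continuousOn)

/-! ## §1 Letters -/

section Letters

/-- `x < ε′·c` for every `ε′` of the shell `(e, a]` and `0 < c` ⇒ `x ≤ e·c` (the shell accumulates at `e`). [folklore] -/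
theorem le_mul_of_forall_shell {x e a c : ℝ} (hea : e < a) (hc : 0 < c) (hx : ∀ ε' : ℝ, e < ε' → ε' ≤ a → x < ε' * c) : x ≤ e * c := by
  refine le_of_not_gt fun h => ?_
  -- `ε′ := min a (x / c)` lies in the shell and violates `x < ε′·c`
  have hxc : e < x / c := by rwa [lt_div_iff₀ hc]
  have h1 : e < min a (x / c) := lt_min hea hxc
  have h2 := hx (min a (x / c)) h1 (min_le_left _ _)
  have h3 : min a (x / c) * c ≤ x / c * c := mul_le_mul_of_nonneg_right (min_le_right _ _) hc.le
  rw [div_mul_cancel₀ x hc.ne'] at h3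
  exact absurd (h2.trans_le h3) (lt_irrefl x)

variable (F : T3Family)

/-- `SU(2)` is second countable (a subspace of `M₂(ℂ)`). [folklore] -/
theorem secondCountableTopology_su2 : SecondCountableTopology (Matrix.specialUnitaryGroup (Fin 2) ℂ) := by
  haveI := secondCountableTopology_matrix (n := Fin 2)
  exact ((continuous_fundamentalRep (Fin 2)).isClosedEmbedding (fundamentalRep_injective (Fin 2))).isEmbedding.secondCountableTopology

/-- `SU(2)` is Polish (a closed subspace of `M₂(ℂ)`). [folklore] -/
theorem polishSpace_su2 : PolishSpace (Matrix.specialUnitaryGroup (Fin 2) ℂ) := by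
  haveI : PolishSpace (Matrix (Fin 2) (Fin 2) ℂ) := inferInstanceAs (PolishSpace (Fin 2 → Fin 2 → ℂ))
  exact ((continuous_fundamentalRep (Fin 2)).isClosedEmbedding (fundamentalRep_injective (Fin 2))).polishSpace

/-- `e(V) = max_p |V(∂p) − 1|` is a measurable function of the datum (countable supremum of continuous functions). [folklore] -/
theorem measurable_iSup_dist1 (n : ℕ) :
    Measurable fun V : GaugeField (F.P n) 0 (Matrix.specialUnitaryGroup (Fin 2) ℂ) =>
      ⨆ q : Plaq (F.P n) 0, GaugeGroup.dist1 (GaugeField.plaqHol V q) := by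
  haveI := secondCountableTopology_su2
  haveI : BorelSpace (GaugeField (F.P n) 0 (Matrix.specialUnitaryGroup (Fin 2) ℂ)) :=
    inferInstanceAs (BorelSpace (PBond (F.P n) 0 → Matrix.specialUnitaryGroup (Fin 2) ℂ))
  exact Measurable.iSup fun q => (continuous_dist1_plaqHol (N := 2) q).measurable

end Letters

/-! ## §2 ★ A measurable selection among the uniform witnesses -/

section Selector

variable (F : T3Family)

/-- ★ **THE r1-PIN LEMMA, MEASURABLE FORM AT ONE COMPARISON HEIGHT.**  Under the hypotheses of `exists_uniform_regMinimiser` ([7] Thm 1 global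
reading at `(a₀, a₁, B₃)`, `0 < B₃`, `B₃a₁ ≤ a₀`, `2B₃a₁` admissible for Prop. 2), for every `n < K` there is a MEASURABLE map
`Umin : GaugeField (F.P n) 0 → GaugeField (F.P K) 0` such that for every admissible `(ε₁, ε₀)` and every `ε₁`-small datum `V`: `Umin V` lies in the
space (8) at `B₃ε₁` and minimises the Wilson action over the space (6) at `ε₀`.  Castaing selection for the action over the closed-graph correspondence
`V ↦ T(V)` inside the open class `{|U(∂p) − 1| < regThreshold(B₃a₁)}` where the descent is continuous; the uniform witness of the existence half lies in
`T(V)` and minimises there, and every member of `T(V)` lies in every space (8) of the shell. [cite: Balaban1985Variational, Thm 1 (6)–(8) pp.278–279; AliprantisBorder2006, Thm 18.19 p.605] -/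
theorem exists_measurable_umin {a₀ a₁ B₃ : ℝ} (hT : Thm1GlobalMinAt F.L a₀ a₁ B₃) (hB₃ : 0 < B₃) (hwin : B₃ * a₁ ≤ a₀)
    (hA3 : (143 * ((((3 + 4 : ℕ) : ℝ)) ^ 2 / 4) ^ 2) * (2 * (B₃ * a₁)) ≤ 1 / 3)
    (hA2 : 2 * (2 * (B₃ * a₁)) ≤ 2 * deltaSU (Fin 2) / (((3 + 4) * F.L : ℕ) : ℝ) ^ 2)
    (n K : ℕ) (hnK : n < K) :
    ∃ Umin : GaugeField (F.P n) 0 (Matrix.specialUnitaryGroup (Fin 2) ℂ) → GaugeField (F.P K) 0 (Matrix.specialUnitaryGroup (Fin 2) ℂ),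
      Measurable Umin ∧
        ∀ (ε₁ ε₀ : ℝ), 0 < ε₁ → ε₁ ≤ a₁ → B₃ * ε₁ ≤ ε₀ → ε₀ ≤ a₀ →
          ∀ V : GaugeField (F.P n) 0 (Matrix.specialUnitaryGroup (Fin 2) ℂ), PlaqSmall ε₁ V →
            Umin V ∈ regFibrePr F n K hnK.le (B₃ * ε₁) V ∧
              IsMinOn (fun W : GaugeField (F.P K) 0 (Matrix.specialUnitaryGroup (Fin 2) ℂ) => wilsonAction4 W)
                (regFibrePr F n K hnK.le ε₀ V) (Umin V) := by
  classical
  -- degenerate constants: an empty shell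
  by_cases ha₁ : 0 < a₁
  swap
  · exact ⟨fun _ => 1, measurable_const, fun ε₁ ε₀ h₁ h₂ _ _ _ _ => absurd (h₁.trans_le h₂) ha₁⟩
  have hr : 0 < B₃ * a₁ := mul_pos hB₃ ha₁
  -- the configuration spaces: compact Polish, Borel = product σ-algebra
  haveI := secondCountableTopology_su2
  haveI := polishSpace_su2
  haveI : CompactSpace (GaugeField (F.P K) 0 (Matrix.specialUnitaryGroup (Fin 2) ℂ)) :=
    inferInstanceAs (CompactSpace (PBond (F.P K) 0 → Matrix.specialUnitaryGroup (Fin 2) ℂ))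
  haveI : PolishSpace (GaugeField (F.P K) 0 (Matrix.specialUnitaryGroup (Fin 2) ℂ)) :=
    inferInstanceAs (PolishSpace (PBond (F.P K) 0 → Matrix.specialUnitaryGroup (Fin 2) ℂ))
  haveI : BorelSpace (GaugeField (F.P K) 0 (Matrix.specialUnitaryGroup (Fin 2) ℂ)) :=
    inferInstanceAs (BorelSpace (PBond (F.P K) 0 → Matrix.specialUnitaryGroup (Fin 2) ℂ))
  haveI : SecondCountableTopology (GaugeField (F.P n) 0 (Matrix.specialUnitaryGroup (Fin 2) ℂ)) :=
    inferInstanceAs (SecondCountableTopology (PBond (F.P n) 0 → Matrix.specialUnitaryGroup (Fin 2) ℂ))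
  haveI : BorelSpace (GaugeField (F.P n) 0 (Matrix.specialUnitaryGroup (Fin 2) ℂ)) :=
    inferInstanceAs (BorelSpace (PBond (F.P n) 0 → Matrix.specialUnitaryGroup (Fin 2) ℂ))
  haveI : T2Space (GaugeField (F.P n) 0 (Matrix.specialUnitaryGroup (Fin 2) ℂ)) :=
    inferInstanceAs (T2Space (PBond (F.P n) 0 → Matrix.specialUnitaryGroup (Fin 2) ℂ))
  -- letters: the largest plaquette deviation `e(V)`, the two thresholds of `T(V)`
  set e : GaugeField (F.P n) 0 (Matrix.specialUnitaryGroup (Fin 2) ℂ) → ℝ := fun V =>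
    ⨆ q : Plaq (F.P n) 0, GaugeGroup.dist1 (GaugeField.plaqHol V q) with he_def
  have he_meas : Measurable e := measurable_iSup_dist1 F n
  set c₁ : ℝ := ((F.L : ℝ)⁻¹) ^ (2 * (K - n)) with hc₁_def
  set c₂ : ℝ := ((F.L : ℝ)⁻¹) ^ (3 * (K - n)) with hc₂_def
  have hLinv : (0 : ℝ) < (F.L : ℝ)⁻¹ := by
    have := F.hL.2
    exact inv_pos.mpr (by exact_mod_cast (by omega : 0 < F.L))
  have hc₁ : 0 < c₁ := pow_pos hLinv _
  have hc₂ : 0 < c₂ := pow_pos hLinv _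
  have hthr : ∀ ε : ℝ, regThreshold F n K ε = ε * c₁ := fun ε => rfl
  -- the data of the selection problem
  set Z : Type := GaugeField (F.P n) 0 (Matrix.specialUnitaryGroup (Fin 2) ℂ) × ((Plaq (F.P K) 0 → ℝ) × (PBond (F.P K) 0 → ℝ)) with hZ_def
  set π : GaugeField (F.P n) 0 (Matrix.specialUnitaryGroup (Fin 2) ℂ) → Z := fun V =>
    (V, (fun _ => (B₃ * e V) * c₁, fun _ => (B₃ * e V) * c₂)) with hπ_def
  set g : GaugeField (F.P K) 0 (Matrix.specialUnitaryGroup (Fin 2) ℂ) → Z := fun U =>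
    (descendTo F ℰp n K hnK.le U, (fun p => GaugeGroup.dist1 (GaugeField.plaqHol U p),
      fun b => ‖covDivT 1 (unitsField (toUField U)) b.dir b.src‖)) with hg_def
  set R : Set (Z × Z) := {q | q.1.1 = q.2.1 ∧ (∀ p, q.1.2.1 p ≤ q.2.2.1 p) ∧ ∀ b, q.1.2.2 b ≤ q.2.2.2 b} with hR_def
  set O : Set (GaugeField (F.P K) 0 (Matrix.specialUnitaryGroup (Fin 2) ℂ)) := {U | PlaqSmall (regThreshold F n K (B₃ * a₁)) U} with hO_def
  have hπ : Measurable π := by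
    refine measurable_id.prodMk (Measurable.prodMk ?_ ?_)
    · exact measurable_pi_lambda _ fun _ => (he_meas.const_mul B₃).mul_const c₁
    · exact measurable_pi_lambda _ fun _ => (he_meas.const_mul B₃).mul_const c₂
  have hO : IsOpen O := by
    simp only [hO_def, PlaqSmall, setOf_forall]
    exact isOpen_iInter_of_finite fun p => isOpen_lt (continuous_dist1_plaqHol (N := 2) p) continuous_const
  have hg : ContinuousOn g O := by
    refine ContinuousOn.prodMk (fun U hU => ?_) (Continuous.continuousOn ?_)
    · exact (continuousAt_descendTo_of_plaqLe F n K hnK.le hr hA3 hA2 le_rfl fun p => (hU p).le).continuousWithinAt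
    · exact (continuous_pi fun p => continuous_dist1_plaqHol (N := 2) p).prodMk
        (continuous_pi fun b => (continuous_covDivT b.dir b.src).norm)
  have hR : IsClosed R := by
    have h1 : IsClosed {q : Z × Z | q.1.1 = q.2.1} := isClosed_eq (continuous_fst.comp continuous_fst) (continuous_fst.comp continuous_snd)
    have h2 : IsClosed {q : Z × Z | ∀ p, q.1.2.1 p ≤ q.2.2.1 p} := by
      simp only [setOf_forall]
      exact isClosed_iInter fun p => isClosed_le
        ((continuous_apply p).comp (continuous_fst.comp (continuous_snd.comp continuous_fst)))
        ((continuous_apply p).comp (continuous_fst.comp (continuous_snd.comp continuous_snd)))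
    have h3 : IsClosed {q : Z × Z | ∀ b, q.1.2.2 b ≤ q.2.2.2 b} := by
      simp only [setOf_forall]
      exact isClosed_iInter fun b => isClosed_le
        ((continuous_apply b).comp (continuous_snd.comp (continuous_snd.comp continuous_fst)))
        ((continuous_apply b).comp (continuous_snd.comp (continuous_snd.comp continuous_snd)))
    simpa only [hR_def, setOf_and] using h1.inter (h2.inter h3)
  obtain ⟨f, hfm, hfin, -⟩ := exists_measurable_constrained_argmin_of_continuousOn hπ hO hg hR
    (continuous_wilsonAction4 (N := 2) (P := F.P K) (j := 0)) 1
  -- reading the admissible set `{U ∈ O | (g U, π V) ∈ R}`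
  have hadm : ∀ (U : GaugeField (F.P K) 0 (Matrix.specialUnitaryGroup (Fin 2) ℂ)) (V : GaugeField (F.P n) 0 (Matrix.specialUnitaryGroup (Fin 2) ℂ)),
      (U ∈ O ∧ (g U, π V) ∈ R) ↔ (PlaqSmall (regThreshold F n K (B₃ * a₁)) U ∧ descendTo F ℰp n K hnK.le U = V ∧
        (∀ p, GaugeGroup.dist1 (GaugeField.plaqHol U p) ≤ (B₃ * e V) * c₁) ∧
          ∀ b : PBond (F.P K) 0, ‖covDivT 1 (unitsField (toUField U)) b.dir b.src‖ ≤ (B₃ * e V) * c₂) := fun U V => by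
    simp only [hO_def, hg_def, hπ_def, hR_def, mem_setOf_eq]
  refine ⟨f, hfm, fun ε₁ ε₀ hε₁ hε₁a hBε hε₀ V hV => ?_⟩
  have heV : e V < ε₁ := iSup_dist1_lt_of_plaqSmall F V hε₁ hV
  have hea : e V < a₁ := heV.trans_le hε₁a
  -- every admissible `U` lies in the space (8) at `B₃ε₁` (the `≤`-clauses at `B₃e(V)` are strict at `B₃ε₁`)
  have hmem : ∀ U, (U ∈ O ∧ (g U, π V) ∈ R) → U ∈ regFibrePr F n K hnK.le (B₃ * ε₁) V := fun U hU => by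
    obtain ⟨-, hfib, hpl, hdv⟩ := (hadm U V).mp hU
    have hlt : B₃ * e V < B₃ * ε₁ := mul_lt_mul_of_pos_left heV hB₃
    refine ⟨⟨hfib, fun p => (hpl p).trans_lt ?_⟩, fun b => (hdv b).trans_lt (mul_lt_mul_of_pos_right hlt hc₂)⟩
    rw [hthr]
    exact mul_lt_mul_of_pos_right hlt hc₁
  -- the uniform witness is admissible and minimises the action over the admissible set
  obtain ⟨U₀, hU₀⟩ := exists_uniform_regMinimiser F hT hB₃ hwin hA3 hA2 n K hnK V
  have hU₀sh : ∀ ε' : ℝ, e V < ε' → ε' ≤ a₁ → U₀ ∈ regFibrePr F n K hnK.le (B₃ * ε') V := fun ε' h₁ h₂ =>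
    (hU₀ ε' a₀ ((iSup_dist1_nonneg F V).trans_lt h₁) h₂ ((mul_le_mul_of_nonneg_left h₂ hB₃.le).trans hwin) le_rfl
      (plaqSmall_of_iSup_dist1_lt F V h₁)).1
  have hU₀adm : U₀ ∈ O ∧ (g U₀, π V) ∈ R := by
    rw [hadm]
    have hpl : ∀ p, GaugeGroup.dist1 (GaugeField.plaqHol U₀ p) ≤ (B₃ * e V) * c₁ := fun p => by
      rw [show (B₃ * e V) * c₁ = e V * (B₃ * c₁) by ring]
      refine le_mul_of_forall_shell hea (mul_pos hB₃ hc₁) fun ε' h₁ h₂ => ?_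
      have := (hU₀sh ε' h₁ h₂).1.2 p
      rw [hthr, show (B₃ * ε') * c₁ = ε' * (B₃ * c₁) by ring] at this
      exact this
    have hdv : ∀ b : PBond (F.P K) 0, ‖covDivT 1 (unitsField (toUField U₀)) b.dir b.src‖ ≤ (B₃ * e V) * c₂ := fun b => by
      rw [show (B₃ * e V) * c₂ = e V * (B₃ * c₂) by ring]
      refine le_mul_of_forall_shell hea (mul_pos hB₃ hc₂) fun ε' h₁ h₂ => ?_
      have := (hU₀sh ε' h₁ h₂).2 b
      rw [show (B₃ * ε') * ((F.L : ℝ)⁻¹) ^ (3 * (K - n)) = ε' * (B₃ * c₂) by rw [hc₂_def]; ring] at this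
      exact this
    refine ⟨fun p => (hpl p).trans_lt ?_, (hU₀sh ε₁ heV hε₁a).1.1, hpl, hdv⟩
    rw [hthr]
    exact mul_lt_mul_of_pos_right (mul_lt_mul_of_pos_left hea hB₃) hc₁
  have hU₀min : IsMinOn (fun W : GaugeField (F.P K) 0 (Matrix.specialUnitaryGroup (Fin 2) ℂ) => wilsonAction4 W)
      (regFibrePr F n K hnK.le ε₀ V) U₀ := (hU₀ ε₁ ε₀ hε₁ hε₁a hBε hε₀ hV).2
  have hex : ∃ y, (y ∈ O ∧ (g y, π V) ∈ R) ∧ ∀ z, z ∈ O ∧ (g z, π V) ∈ R → wilsonAction4 y ≤ wilsonAction4 z :=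
    ⟨U₀, hU₀adm, fun z hz => hU₀min (regFibrePr_mono F hBε V (hmem z hz))⟩
  obtain ⟨hf₁, hf₂⟩ := hfin V hex
  refine ⟨hmem (f V) hf₁, fun W hW => ?_⟩
  show wilsonAction4 (f V) ≤ wilsonAction4 W
  have h0W : wilsonAction4 U₀ ≤ wilsonAction4 W := hU₀min hW
  exact (hf₂ U₀ hU₀adm).trans h0W

end Selector

/-! ## §3 ★★ The pinned family of run `K` with the record's r1 text -/

section Pinned

variable (F : T3Family)

/-- Re-indexing bookkeeping: a family `Umin n` indexed by the comparison height, read at an index `n₁` propositionally equal to `n₂` through two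
`fieldShift`s that compose to the identity. [cite: Balaban1987RG1, (0.1) p.251 (bookkeeping)] -/
theorem umin_fieldShift_fieldShift {K : ℕ}
    (Umin : (n : ℕ) → GaugeField (F.P n) 0 (Matrix.specialUnitaryGroup (Fin 2) ℂ) → GaugeField (F.P K) 0 (Matrix.specialUnitaryGroup (Fin 2) ℂ))
    {n₁ n₂ k : ℕ} (h12 : n₁ = n₂) (e₁ : (F.PP F.m n₁).sitesPerDir 0 = (F.PP F.m K).sitesPerDir k)
    (e₂ : (F.PP F.m K).sitesPerDir k = (F.PP F.m n₂).sitesPerDir 0) (V : GaugeField (F.P n₂) 0 (Matrix.specialUnitaryGroup (Fin 2) ℂ)) :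
    Umin n₁ (fieldShift e₁ (fieldShift e₂ V)) = Umin n₂ V := by
  subst h12
  rw [fieldShift_fieldShift, fieldShift_refl]

/-- ★★ **THE PINNED TRIVIAL-HISTORY MINIMISERS OF RUN `K` WITH THE RECORD'S ROW r1.**  Under the hypotheses of `exists_uniform_regMinimiser` there is a
family `UminT : (k : ℕ) → GaugeField (F.P K) k → GaugeField (F.P K) 0` with (i) every `UminT k` MEASURABLE, (ii) `UminT 0 = id`, (iii) THE TEXT of
`AlphaInputsT3ACv2.MinimiserRowsT3`, conjunct 1, with `U_k(·, triv) := UminT k`: for `n < K`, `0 < ε₁ ≤ a₁`, `B₃ε₁ ≤ ε₀ ≤ a₀` and every `ε₁`-small datum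
`V` of the `n`-th approximation, `UminT (K − n) (fieldShift _ V)` lies in `regFibrePr F n K _ (B₃ε₁) V` and minimises the Wilson action over
`regFibrePr F n K _ ε₀ V`.  A composite-minimiser family with `UkH k (Hist.triv _ k) := UminT k` (and `Uk k := UminT (k + 1)`) therefore satisfies the
record's `hU0`, `hUs`, r1, and the measurability rows at the trivial history. [cite: Balaban1985Variational, Thm 1 (6)–(8) pp.278–279; AliprantisBorder2006, Thm 18.19 p.605] -/
theorem exists_measurable_pinnedFamily {a₀ a₁ B₃ : ℝ} (hT : Thm1GlobalMinAt F.L a₀ a₁ B₃) (hB₃ : 0 < B₃) (hwin : B₃ * a₁ ≤ a₀)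
    (hA3 : (143 * ((((3 + 4 : ℕ) : ℝ)) ^ 2 / 4) ^ 2) * (2 * (B₃ * a₁)) ≤ 1 / 3)
    (hA2 : 2 * (2 * (B₃ * a₁)) ≤ 2 * deltaSU (Fin 2) / (((3 + 4) * F.L : ℕ) : ℝ) ^ 2) (K : ℕ) :
    ∃ UminT : (k : ℕ) → GaugeField (F.P K) k (Matrix.specialUnitaryGroup (Fin 2) ℂ) →
        GaugeField (F.P K) 0 (Matrix.specialUnitaryGroup (Fin 2) ℂ),
      (∀ k, Measurable (UminT k)) ∧
      (∀ V : GaugeField (F.P K) 0 (Matrix.specialUnitaryGroup (Fin 2) ℂ), UminT 0 V = V) ∧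
      ∀ (n : ℕ) (hnK : n < K) (ε₁ ε₀ : ℝ), 0 < ε₁ → ε₁ ≤ a₁ → B₃ * ε₁ ≤ ε₀ → ε₀ ≤ a₀ →
        ∀ V : GaugeField (F.P n) 0 (Matrix.specialUnitaryGroup (Fin 2) ℂ), PlaqSmall ε₁ V →
          UminT (K - n) (fieldShift (F.sitesPerDir_eq (m := F.m) (K := K) (j := K - n) (m' := F.m) (K' := n) (j' := 0) (by omega)) V) ∈
              regFibrePr F n K hnK.le (B₃ * ε₁) V ∧
            IsMinOn (fun U : GaugeField (F.P K) 0 (Matrix.specialUnitaryGroup (Fin 2) ℂ) => wilsonAction4 U)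
              (regFibrePr F n K hnK.le ε₀ V)
              (UminT (K - n)
                (fieldShift (F.sitesPerDir_eq (m := F.m) (K := K) (j := K - n) (m' := F.m) (K' := n) (j' := 0) (by omega)) V)) := by
  classical
  -- a measurable selector at every comparison height (junk beyond the run)
  have key : ∀ n : ℕ, ∃ Umin : GaugeField (F.P n) 0 (Matrix.specialUnitaryGroup (Fin 2) ℂ) →
      GaugeField (F.P K) 0 (Matrix.specialUnitaryGroup (Fin 2) ℂ), Measurable Umin ∧
        ∀ (hnK : n < K) (ε₁ ε₀ : ℝ), 0 < ε₁ → ε₁ ≤ a₁ → B₃ * ε₁ ≤ ε₀ → ε₀ ≤ a₀ →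
          ∀ V : GaugeField (F.P n) 0 (Matrix.specialUnitaryGroup (Fin 2) ℂ), PlaqSmall ε₁ V →
            Umin V ∈ regFibrePr F n K hnK.le (B₃ * ε₁) V ∧
              IsMinOn (fun W : GaugeField (F.P K) 0 (Matrix.specialUnitaryGroup (Fin 2) ℂ) => wilsonAction4 W)
                (regFibrePr F n K hnK.le ε₀ V) (Umin V) := by
    intro n
    by_cases hnK : n < K
    · obtain ⟨Umin, hm, hU⟩ := exists_measurable_umin F hT hB₃ hwin hA3 hA2 n K hnK
      exact ⟨Umin, hm, fun _ => hU⟩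
    · exact ⟨fun _ => 1, measurable_const, fun h => absurd h hnK⟩
  choose Umin hUmeas hUmin using key
  -- the family over the levels of run `K`: `k = 0` the identity, `1 ≤ k ≤ K` the selector at height `K − k`, junk beyond
  refine ⟨fun k W => if hk : 1 ≤ k ∧ k ≤ K then
      Umin (K - k) (fieldShift (F.sitesPerDir_eq (m := F.m) (K := K - k) (j := 0) (m' := F.m) (K' := K) (j' := k) (by omega)) W)
    else if hk0 : k = 0 then fieldShift (F.sitesPerDir_eq (m := F.m) (K := K) (j := 0) (m' := F.m) (K' := K) (j' := k) (by omega)) W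
    else 1, fun k => ?_, fun V => ?_, fun n hnK ε₁ ε₀ h₁ h₂ h₃ h₄ V hV => ?_⟩
  · -- measurability, branch by branch
    by_cases hk : 1 ≤ k ∧ k ≤ K
    · simp only [dif_pos hk]
      exact (hUmeas _).comp (measurable_fieldShift _)
    · by_cases hk0 : k = 0
      · simp only [dif_neg hk, dif_pos hk0]
        exact measurable_fieldShift _
      · simp only [dif_neg hk, dif_neg hk0]
        exact measurable_const
  · -- level `0` is the identity
    have h0 : ¬ (1 ≤ 0 ∧ 0 ≤ K) := fun h => absurd h.1 (by omega)
    beta_reduce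
    rw [dif_neg h0, dif_pos rfl]
    exact fieldShift_refl _ V
  · -- the r1 text at `k = K − n`
    have hk : 1 ≤ K - n ∧ K - n ≤ K := ⟨by omega, by omega⟩
    beta_reduce
    rw [dif_pos hk]
    rw [umin_fieldShift_fieldShift F Umin (Nat.sub_sub_self hnK.le)]
    exact hUmin n hnK ε₁ ε₀ h₁ h₂ h₃ h₄ V hV

end Pinned

end Summit.QuantumFields.YangMills.Theorems.MinimiserPin

end
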